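import Summits.QuantumFields.BalabanUV.Beta.FP.FFPerturbationCarrier
import Literature.MathematicalPhysics.QuantumFieldTheory.Balaban1983to89.Beta.KernelReflection

/-!
# `BalabanUV.Beta.FP.FFPerturbationHessWords` — road «FP» for binder row D1, row **N2a-ENG v2** (owner d1-p3, `N2B-DESIGN.md` v1.3 §7; OWNER WORD l.32887
# «`D m = D_E m`»): THE GENERIC HALF OF THE `D_E` WORD LIST, HESSIAN SIDE — (i) the ASSEMBLED carrier identity under an1's letters,
# `W2OfK (A + E) … μ y ν y′ = W2OfK A … μ y ν y′ − dM (A∘D∘E + E∘D∘A + E∘D∘E) N S M μ y` (`D := dM A N S M ν y′`; ff-supported `E`), and its `W2SymOfK` form;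
# (ii) the `A`-slot words of the resolvent Hessian kernel: `hessKer (A + E) V W′ μ ν z = hessKer A V W μ ν z + ½·tadpole E (W μ 0 ν z) + ½·tadpole (A + E) (W′ − W) μ 0 ν z
# − ½·(tr (A∘V_μ ∘ E∘V_ν) + tr (E∘V_μ ∘ A∘V_ν) + bubble E V_μ V_ν)` — tadpole ONE word, bubble TWO single-`E` + ONE double-`E` word (the owner's count «2+1, 1, 2+1»)

HONEST DEPENDENCY (page 1, mandatory): continuum YM on T⁴ ⇐ BetaPertH ∧ nine spine estimates (0/9 proved); BetaPertH ⇐ (D1) ∧ (D4) ∧ CAP+tail;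
G-an2-4 gates asym, D1 and NE2/3/4.  HONEST FRAMING (cell contract, verbatim): «discharging `BetaPertH` makes Bałaban's UV stability UNCONDITIONAL —
a real constructive-QFT result; it is NOT the continuum limit and NOT the Clay problem.»  THIS MODULE is [folklore] multilinear algebra of absolutely
convergent lattice kernels (every `tr`∕`comp` split justified by an an2∕asym1 summability letter BY NAME: `summable_trTerm`, `biLoc_comp_decays`,
`biLoc_comp_biLoc`, `biLoc_comp_right`, `slices_bdd_biLoc`, `slices_biLoc_bdd`, an1's `vertexFamily_dM`∕`vertexFamily_K2OfK`); GENERIC `d`, `N`, kernels and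
tables — NOTHING of the perfect objects is instantiated; no `def`, no `def … : Prop`, nothing cited, 0 sorry.  0∕4 row-D1 binders; NOT N2a (generic half of its
word list), NOT SDF, NOT D1, NOT BetaPertH, NOT continuum, NOT Clay.  «not in print; our bookkeeping».

ABSOLUTE RULE (cell charter, verbatim): «No internally-minted statement may enter as a cited fact. Every hypothesis is either kernel-proved in this
package or a verbatim quotation of a PUBLISHED theorem with page reference. The manuscript(s) under audit are NOT citable for their own disputed
steps — they are the thing under adjudication; programme-internal (2001/route/tribunal) claims are never citable.»

CONTENT.
* §1 trace words (generic `D`, `F`; an2's `StepJetData.comp_add_right`∕`tr_add` BY NAME): `tadpole_add_kernel` (`tadpole (A + E) W = tadpole A W + tadpole E W`), `tadpole_add_vertex` (`tadpole A (W + W′) = tadpole A W + tadpole A W′`),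
  **`bubble_add_kernel_words`** (`bubble (A + E) Vp Vq = bubble A Vp Vq + (tr ((A∘Vp)∘(E∘Vq)) + tr ((E∘Vp)∘(A∘Vq)) + bubble E Vp Vq)`).
* §2 **`hessKer_add_kernel_words`** (families `V`, `W`, `W′`; `A`, `E` decaying): the displayed identity (ii).
* §3 **`W2OfK_add_words`** — the assembled carrier identity (i) under `Decays A C δ`, `Decays E CE δ`, `LocStencil S Cs δ`, `VertexFamily M N CM δ`, `δ > 0`, `N ≥ 1`
  (letter `biLoc_words` inside); **`W2SymOfK_add_words`** (the swap-symmetrised form).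
* §4 `decays_add_pi`, **`hessKer_ffPerturb_words`** — THE GENERIC `D_E` WORD LIST: `hessKer (A + E) (vertexOfK (A + E) N S) (W2SymOfK (A + E) …) μ ν z` = the same for `A`
  `+ ½·tadpole E W₀(μ,0;ν,z) − ¼·tadpole (A + E) (dM W₃(ν,z) … μ 0 + dM W₃(μ,0) … ν z) − ½·(tr (A∘V₀(μ,0) ∘ E∘V₀(ν,z)) + tr (E∘V₀(μ,0) ∘ A∘V₀(ν,z)) + bubble E V₀(μ,0) V₀(ν,z))`
  (`V₀ := vertexOfK A N S`, `W₀ := W2SymOfK A …`, `W₃(b) :=` the three sandwich words at the bond `b`) under an1's letters at one rate `δ`.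
Provenance: D1 formalisation swarm LEAF PROVER 06, unit b2b-balaban-beta-d1-formalise-leaf-06 gen 14 (prover-b2b-balaban-beta-d1-formalise-leaf-06-g14-0), 2026-08-21
(journal INTENT 3 l.32955; leaf-01 g16 co-first-refusal GO + precision P-d1leaf01g16-1 l.33023 — under `dM` only the word `E∘D∘A` survives,
their add-on `FP/FFPerturbationSandwichNull`); no existing file touched.
-/

noncomputable section

namespace Summit.QuantumFields.BalabanUV.Beta.FP.FFPerturbationHessWords

open Literature.MathematicalPhysics.QuantumFieldTheory
open Literature.MathematicalPhysics.QuantumFieldTheory.Balaban1983to89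
open Literature.MathematicalPhysics.QuantumFieldTheory.Balaban1983to89.Beta
open B12Sec2to5 (l1 l1_nonneg)
open ExpKernelCalculus (MKer comp tr tadpole bubble hessKer Decays BiLoc VertexFamily VertexFamily₂ biLoc_comp_decays biLoc_comp_biLoc summable_trTerm)
open OneStepResolventKernel (Fib LocStencil decays_mono biLoc_mono)
open BalabanCompositeJets (LocStencil₂)
open OneStepKernelFamily (colH vertexOfK)
open KernelWard (Bdd bdd_of_decays bdd_of_biLoc slices_bdd_biLoc slices_biLoc_bdd biLoc_add biLoc_sub tr_sub)
open BalabanStepJetsSucc (biLoc_comp_right)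
open SecondOrderResponse (colM vertexOfM dM K2OfK vertex2OfK mixOfK W2OfK W2SymOfK LocStencilFM vertexFamily_dM vertexFamily_K2OfK vertexFamily₂_W2SymOfK)
open OneStepKernelFamily (vertexFamily_vertexOfK)
open KernelReflection (tadpole_smul)
open StepJetData (comp_add_right tr_add)
open FFPerturbationCarrier (comp_add_left bdd_add vertexOfK_add_of_fm W2OfK_add_of_fm_mm K2OfK_add_words dM_sub_kernel)

/-! ## §1 Trace words -/

section Trace

variable {D : ℕ} {F : Type*} [Fintype F]

/-- [folklore] **THE TADPOLE IS ADDITIVE IN THE KERNEL SLOT**: `tadpole (A + E) W = tadpole A W + tadpole E W` (decaying `A`, `E`; `W` bi-localised; rate `δ > 0`). -/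
theorem tadpole_add_kernel {A E W : ExpKernelCalculus.MKer D F} {C CE Cw δ : ℝ} {p q : Fin D → ℤ} (hA : Decays A C δ) (hE : Decays E CE δ)
    (hW : BiLoc W p q Cw δ) (hδ : 0 < δ) : tadpole (A + E) W = tadpole A W + tadpole E W := by
  have hδ2 : 0 < δ / 2 := by linarith
  unfold ExpKernelCalculus.tadpole
  rw [comp_add_left (slices_bdd_biLoc (bdd_of_decays hA hδ.le) hW hδ) (slices_bdd_biLoc (bdd_of_decays hE hδ.le) hW hδ),
    tr_add (summable_trTerm (biLoc_comp_decays hA hW hδ2.le (by linarith)) hδ2)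
      (summable_trTerm (biLoc_comp_decays hE hW hδ2.le (by linarith)) hδ2)]

/-- [folklore] **THE TADPOLE IS ADDITIVE IN THE VERTEX SLOT**: `tadpole A (W + W′) = tadpole A W + tadpole A W′`. -/
theorem tadpole_add_vertex {A W W' : ExpKernelCalculus.MKer D F} {C Cw Cw' δ : ℝ} {p q p' q' : Fin D → ℤ} (hA : Decays A C δ)
    (hW : BiLoc W p q Cw δ) (hW' : BiLoc W' p' q' Cw' δ) (hδ : 0 < δ) : tadpole A (W + W') = tadpole A W + tadpole A W' := by
  have hδ2 : 0 < δ / 2 := by linarith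
  have hAb := bdd_of_decays hA hδ.le
  unfold ExpKernelCalculus.tadpole
  rw [comp_add_right (slices_bdd_biLoc hAb hW hδ) (slices_bdd_biLoc hAb hW' hδ),
    tr_add (summable_trTerm (biLoc_comp_decays hA hW hδ2.le (by linarith)) hδ2)
      (summable_trTerm (biLoc_comp_decays hA hW' hδ2.le (by linarith)) hδ2)]

/-- [folklore] **THE BUBBLE WITH A PERTURBED KERNEL, AS WORDS**: `bubble (A + E) Vp Vq = bubble A Vp Vq + (tr ((A∘Vp)∘(E∘Vq)) + tr ((E∘Vp)∘(A∘Vq)) + bubble E Vp Vq)` —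
two single-`E` words and the double-`E` word (decaying `A`, `E`; `Vp`, `Vq` bi-localised at `(p,p)`, `(q,q)`; rate `δ > 0`). -/
theorem bubble_add_kernel_words {A E Vp Vq : ExpKernelCalculus.MKer D F} {C CE Cp Cq δ : ℝ} {p q : Fin D → ℤ} (hA : Decays A C δ)
    (hE : Decays E CE δ) (hVp : BiLoc Vp p p Cp δ) (hVq : BiLoc Vq q q Cq δ) (hδ : 0 < δ) :
    bubble (A + E) Vp Vq
      = bubble A Vp Vq + (tr (comp (comp A Vp) (comp E Vq)) + tr (comp (comp E Vp) (comp A Vq)) + bubble E Vp Vq) := by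
  have hδ2 : 0 < δ / 2 := by linarith
  have hAb := bdd_of_decays hA hδ.le
  have hEb := bdd_of_decays hE hδ.le
  -- the four inner products, bi-localised at rate δ/2
  have hAp := biLoc_comp_decays hA hVp hδ2.le (by linarith : δ / 2 < δ)
  have hEp := biLoc_comp_decays hE hVp hδ2.le (by linarith : δ / 2 < δ)
  have hAq := biLoc_comp_decays hA hVq hδ2.le (by linarith : δ / 2 < δ)
  have hEq := biLoc_comp_decays hE hVq hδ2.le (by linarith : δ / 2 < δ)
  unfold ExpKernelCalculus.bubble
  rw [comp_add_left (slices_bdd_biLoc hAb hVp hδ) (slices_bdd_biLoc hEb hVp hδ),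
    comp_add_left (slices_bdd_biLoc hAb hVq hδ) (slices_bdd_biLoc hEb hVq hδ)]
  -- distribute the outer composition
  have sAA := slices_biLoc_bdd hAp (bdd_of_biLoc hAq hδ2.le) hδ2
  have sAE := slices_biLoc_bdd hAp (bdd_of_biLoc hEq hδ2.le) hδ2
  have sEA := slices_biLoc_bdd hEp (bdd_of_biLoc hAq hδ2.le) hδ2
  have sEE := slices_biLoc_bdd hEp (bdd_of_biLoc hEq hδ2.le) hδ2
  rw [comp_add_left (K := comp A Vp) (L := comp E Vp) (M := comp A Vq + comp E Vq) ?_ ?_]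
  rotate_left
  · intro x z a b
    have := (sAA x z a b).add (sAE x z a b)
    refine this.congr fun y => ?_
    rw [← Finset.sum_add_distrib]
    refine Finset.sum_congr rfl fun f _ => ?_
    simp only [Pi.add_apply]; ring
  · intro x z a b
    have := (sEA x z a b).add (sEE x z a b)
    refine this.congr fun y => ?_
    rw [← Finset.sum_add_distrib]
    refine Finset.sum_congr rfl fun f _ => ?_
    simp only [Pi.add_apply]; ring
  rw [comp_add_right sAA sAE, comp_add_right sEA sEE]
  -- split the traces
  have tAA := summable_trTerm (biLoc_comp_biLoc hAp hAq hδ2) hδ2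
  have tAE := summable_trTerm (biLoc_comp_biLoc hAp hEq hδ2) hδ2
  have tEA := summable_trTerm (biLoc_comp_biLoc hEp hAq hδ2) hδ2
  have tEE := summable_trTerm (biLoc_comp_biLoc hEp hEq hδ2) hδ2
  have tAAAE : Summable fun x : Fin D → ℤ => ∑ a, (comp (comp A Vp) (comp A Vq) + comp (comp A Vp) (comp E Vq)) x x a a := by
    have := tAA.add tAE
    refine this.congr fun x => ?_
    rw [← Finset.sum_add_distrib]; rfl
  have tEAEE : Summable fun x : Fin D → ℤ => ∑ a, (comp (comp E Vp) (comp A Vq) + comp (comp E Vp) (comp E Vq)) x x a a := by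
    have := tEA.add tEE
    refine this.congr fun x => ?_
    rw [← Finset.sum_add_distrib]; rfl
  rw [tr_add tAAAE tEAEE, tr_add tAA tAE, tr_add tEA tEE]
  ring

end Trace

/-! ## §2 The `A`-slot words of the resolvent Hessian kernel -/

section Hess

variable {D : ℕ} {F : Type*} [Fintype F]

/-- [folklore] **THE RESOLVENT HESSIAN KERNEL WITH A PERTURBED KERNEL AND A PERTURBED SECOND-ORDER FAMILY, AS WORDS**: for decaying `A`, `E`, a first-order
family `V` (unchanged — the vertices carry no perturbation word, `FFPerturbationCarrier` §1) and second-order families `W`, `W′` (blocking `N`, rate `δ > 0`):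
`hessKer (A + E) V W′ μ ν z = hessKer A V W μ ν z + ½·tadpole E (W μ 0 ν z) + ½·tadpole (A + E) (W′ μ 0 ν z − W μ 0 ν z)
 − ½·(tr ((A∘V μ 0)∘(E∘V ν z)) + tr ((E∘V μ 0)∘(A∘V ν z)) + bubble E (V μ 0) (V ν z))` — tadpole ONE `E`-word (+ the carrier's own words through `W′ − W`),
bubble TWO single-`E` words and ONE double-`E` word. -/
theorem hessKer_add_kernel_words {A E : ExpKernelCalculus.MKer D F} {V : Fin D → (Fin D → ℤ) → ExpKernelCalculus.MKer D F}
    {W W' : Fin D → (Fin D → ℤ) → Fin D → (Fin D → ℤ) → ExpKernelCalculus.MKer D F} {C CE Cv Cw Cw' δ : ℝ} {N : ℕ}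
    (hA : Decays A C δ) (hE : Decays E CE δ) (hV : VertexFamily V N Cv δ) (hW : VertexFamily₂ W N Cw δ) (hW' : VertexFamily₂ W' N Cw' δ) (hδ : 0 < δ)
    (μ ν : Fin D) (z : Fin D → ℤ) :
    hessKer (A + E) V W' μ ν z
      = hessKer A V W μ ν z + (1 / 2) * tadpole E (W μ 0 ν z) + (1 / 2) * tadpole (A + E) (W' μ 0 ν z - W μ 0 ν z)
        - (1 / 2) * (tr (comp (comp A (V μ 0)) (comp E (V ν z))) + tr (comp (comp E (V μ 0)) (comp A (V ν z))) + bubble E (V μ 0) (V ν z)) := by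
  have hAE : Decays (A + E) (C + CE) δ := fun x y a b => by
    rw [Pi.add_apply, Pi.add_apply, Pi.add_apply, Pi.add_apply, add_mul]
    exact (abs_add_le _ _).trans (add_le_add (hA x y a b) (hE x y a b))
  have hWd : BiLoc (W' μ 0 ν z - W μ 0 ν z) ((N : ℤ) • (0 : Fin D → ℤ)) ((N : ℤ) • z) (Cw' + Cw) δ := biLoc_sub (hW' μ 0 ν z) (hW μ 0 ν z)
  have e1 : W' μ 0 ν z = W μ 0 ν z + (W' μ 0 ν z - W μ 0 ν z) := by abel
  unfold ExpKernelCalculus.hessKer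
  rw [e1, tadpole_add_vertex hAE (hW μ 0 ν z) hWd hδ, tadpole_add_kernel hA hE (hW μ 0 ν z) hδ,
    bubble_add_kernel_words hA hE (hV μ 0) (hV ν z) hδ, ← e1]
  ring

end Hess

/-! ## §3 The assembled carrier identity under an1's letters -/

section Carrier

variable {d : ℕ} {N : ℕ} [NeZero N] {A E : MKer (d + 1) (Fib d)} {C CE Cs CM δ : ℝ}
  {S M : Fin (d + 1) → (Fin (d + 1) → ℤ) → MKer (d + 1) (Fib d)}

/-- [folklore] The three sandwich words at the bond `(ν, y′)` are bi-localised at `(N•y′, N•y′)` with rate `δ/8` (some constant). -/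
theorem biLoc_words (hA : Decays A C δ) (hC : 0 ≤ C) (hE : Decays E CE δ) (hCE : 0 ≤ CE) (hS : LocStencil S Cs δ) (hM : VertexFamily M N CM δ)
    (hδ : 0 < δ) (ν : Fin (d + 1)) (y' : Fin (d + 1) → ℤ) :
    ∃ Cw : ℝ, BiLoc (comp (comp A (dM A N S M ν y')) E + comp (comp E (dM A N S M ν y')) A + comp (comp E (dM A N S M ν y')) E)
      ((N : ℤ) • y') ((N : ℤ) • y') Cw (δ / 8) := by
  have hD := vertexFamily_dM hA hC hS hM hδ le_rfl ν y'
  have hA2 : Decays A C (δ / 2) := decays_mono hA hC le_rfl (by linarith)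
  have hE2 : Decays E CE (δ / 2) := decays_mono hE hCE le_rfl (by linarith)
  have hA4 : Decays A C (δ / 4) := decays_mono hA hC le_rfl (by linarith)
  have hE4 : Decays E CE (δ / 4) := decays_mono hE hCE le_rfl (by linarith)
  have hAD := biLoc_comp_decays hA2 hD (by linarith : (0 : ℝ) ≤ δ / 4) (by linarith : δ / 4 < δ / 2)
  have hED := biLoc_comp_decays hE2 hD (by linarith : (0 : ℝ) ≤ δ / 4) (by linarith : δ / 4 < δ / 2)
  have w1 := biLoc_comp_right hAD hE4 (by linarith : (0 : ℝ) ≤ δ / 8) (by linarith : δ / 8 < δ / 4)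
  have w2 := biLoc_comp_right hED hA4 (by linarith : (0 : ℝ) ≤ δ / 8) (by linarith : δ / 8 < δ / 4)
  have w3 := biLoc_comp_right hED hE4 (by linarith : (0 : ℝ) ≤ δ / 8) (by linarith : δ / 8 < δ / 4)
  exact ⟨_, biLoc_add (biLoc_add w1 w2) w3⟩

/-- [our proof] **THE SECOND-ORDER CARRIER WITH AN ff-SUPPORTED PERTURBATION OF THE RESOLVENT, AS WORDS** (an1's letters: `A`, `E` decaying at rate `δ > 0`,
`S` a `LocStencil`, `M` a `VertexFamily` at blocking `N ≥ 1`; `E` ff-supported; every second-order table `S₂`, `M₂`):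
`W2OfK (A + E) N S M S₂ M₂ μ y ν y′ = W2OfK A N S M S₂ M₂ μ y ν y′ − dM (A∘D∘E + E∘D∘A + E∘D∘E) N S M μ y`, `D := dM A N S M ν y′` — the perturbation enters the
carrier through EXACTLY the three sandwich words of the second response, read through the columns of `dM`. -/
theorem W2OfK_add_words (hfm : ∀ x y (κ μ : Fin (d + 1)), E x y (Sum.inl κ) (Sum.inr μ) = 0)
    (hmm : ∀ x y (ρ μ : Fin (d + 1)), E x y (Sum.inr ρ) (Sum.inr μ) = 0)
    (hA : Decays A C δ) (hC : 0 ≤ C) (hE : Decays E CE δ) (hCE : 0 ≤ CE) (hS : LocStencil S Cs δ) (hM : VertexFamily M N CM δ) (hδ : 0 < δ)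
    (S₂ M₂ : Fin (d + 1) → (Fin (d + 1) → ℤ) → Fin (d + 1) → (Fin (d + 1) → ℤ) → MKer (d + 1) (Fib d))
    (μ : Fin (d + 1)) (y : Fin (d + 1) → ℤ) (ν : Fin (d + 1)) (y' : Fin (d + 1) → ℤ) :
    W2OfK (A + E) N S M S₂ M₂ μ y ν y'
      = W2OfK A N S M S₂ M₂ μ y ν y'
        - dM (comp (comp A (dM A N S M ν y')) E + comp (comp E (dM A N S M ν y')) A + comp (comp E (dM A N S M ν y')) E) N S M μ y := by
  have hD := vertexFamily_dM hA hC hS hM hδ le_rfl ν y'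
  have hK2 := vertexFamily_K2OfK hA hC hδ hS hM ν y'
  obtain ⟨Cw, hW3⟩ := biLoc_words hA hC hE hCE hS hM hδ ν y'
  have hSb : ∀ κ u x z a b, |S κ u x z a b| ≤ Cs := fun κ u x z a b => bdd_of_biLoc (hS κ u) hδ.le x z a b
  have hMb : ∀ ρ w x z a b, |M ρ w x z a b| ≤ CM := fun ρ w x z a b => bdd_of_biLoc (hM ρ w) hδ.le x z a b
  have hA2 : Decays A C (δ / 2) := decays_mono hA hC le_rfl (by linarith)
  have hE2 : Decays E CE (δ / 2) := decays_mono hE hCE le_rfl (by linarith)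
  rw [W2OfK_add_of_fm_mm hfm hmm S M S₂ M₂ μ y ν y', K2OfK_add_words hfm hmm S M ν y' hA2 hE2 hD (by linarith : 0 < δ / 2),
    dM_sub_kernel hK2 hW3 (by linarith : 0 < δ / 8) hSb hMb]
  unfold W2OfK
  abel

/-- [our proof] **THE SWAP-SYMMETRISED CARRIER, AS WORDS**: `W2SymOfK (A + E) … μ y ν y′ = W2SymOfK A … μ y ν y′ − ½ • (dM (W₃ ν y′) … μ y + dM (W₃ μ y) … ν y′)` with `W₃` the
three sandwich words. -/
theorem W2SymOfK_add_words (hfm : ∀ x y (κ μ : Fin (d + 1)), E x y (Sum.inl κ) (Sum.inr μ) = 0)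
    (hmm : ∀ x y (ρ μ : Fin (d + 1)), E x y (Sum.inr ρ) (Sum.inr μ) = 0)
    (hA : Decays A C δ) (hC : 0 ≤ C) (hE : Decays E CE δ) (hCE : 0 ≤ CE) (hS : LocStencil S Cs δ) (hM : VertexFamily M N CM δ) (hδ : 0 < δ)
    (S₂ M₂ : Fin (d + 1) → (Fin (d + 1) → ℤ) → Fin (d + 1) → (Fin (d + 1) → ℤ) → MKer (d + 1) (Fib d))
    (μ : Fin (d + 1)) (y : Fin (d + 1) → ℤ) (ν : Fin (d + 1)) (y' : Fin (d + 1) → ℤ) :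
    W2SymOfK (A + E) N S M S₂ M₂ μ y ν y'
      = W2SymOfK A N S M S₂ M₂ μ y ν y'
        - (1 / 2 : ℝ) • (dM (comp (comp A (dM A N S M ν y')) E + comp (comp E (dM A N S M ν y')) A + comp (comp E (dM A N S M ν y')) E) N S M μ y
          + dM (comp (comp A (dM A N S M μ y)) E + comp (comp E (dM A N S M μ y)) A + comp (comp E (dM A N S M μ y)) E) N S M ν y') := by
  unfold W2SymOfK
  rw [W2OfK_add_words hfm hmm hA hC hE hCE hS hM hδ S₂ M₂ μ y ν y', W2OfK_add_words hfm hmm hA hC hE hCE hS hM hδ S₂ M₂ ν y' μ y]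
  funext x z a b
  simp only [Pi.smul_apply, Pi.sub_apply, Pi.add_apply, smul_eq_mul]
  ring

end Carrier

/-! ## §4 THE GENERIC `D_E` WORD LIST: the resolvent Hessian kernel of an ff-perturbed resolvent, built on its OWN vertices and carrier -/

section WordList

variable {d : ℕ} {N : ℕ} [NeZero N] {A E : MKer (d + 1) (Fib d)} {C CE Cs CM C₂ CM₂ δ : ℝ}
  {S M : Fin (d + 1) → (Fin (d + 1) → ℤ) → MKer (d + 1) (Fib d)}
  {S₂ M₂ : Fin (d + 1) → (Fin (d + 1) → ℤ) → Fin (d + 1) → (Fin (d + 1) → ℤ) → MKer (d + 1) (Fib d)}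

/-- [folklore] Decaying + decaying is decaying (constants add). -/
theorem decays_add_pi {K L : MKer (d + 1) (Fib d)} {B B' r : ℝ} (hK : Decays K B r) (hL : Decays L B' r) : Decays (K + L) (B + B') r :=
  fun x y a b => by
    rw [Pi.add_apply, Pi.add_apply, Pi.add_apply, Pi.add_apply, add_mul]
    exact (abs_add_le _ _).trans (add_le_add (hK x y a b) (hL x y a b))

/-- [our proof] **THE GENERIC `D_E` WORD LIST** (an1's letters, all at one rate `δ > 0`, blocking `N ≥ 1`; `E` ff-SUPPORTED; decaying `A`, `E`): the resolvent Hessian kernel of the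
PERTURBED resolvent `A + E`, built on ITS OWN chain-rule vertices `vertexOfK (A + E) N S` and ITS OWN swap-symmetrised carrier `W2SymOfK (A + E) N S M S₂ M₂`, equals the one
of `A` on its own vertices and carrier PLUS EXPLICIT `E`-WORDS — tadpole: ONE word `½·tadpole E W₀`; carrier: the three sandwich words of `FFPerturbationCarrier` read through `dM` in
both bonds (`−¼·tadpole (A + E) (dM W₃(ν,z) … μ 0 + dM W₃(μ,0) … ν z)`); bubble: TWO single-`E` words and ONE double-`E` word; and NOTHING ELSE (the vertices are `E`-blind).
With `A := A₀` (the BOTTOM-composed perfect kernel) and `E := E♭_m` this is the owner's `D_E m` word list modulo the identification `hessKer A₀ V₀ W₀ = RP m + TP m`. -/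
theorem hessKer_ffPerturb_words (hfm : ∀ x y (κ μ : Fin (d + 1)), E x y (Sum.inl κ) (Sum.inr μ) = 0)
    (hmm : ∀ x y (ρ μ : Fin (d + 1)), E x y (Sum.inr ρ) (Sum.inr μ) = 0)
    (hA : Decays A C δ) (hC : 0 ≤ C) (hE : Decays E CE δ) (hCE : 0 ≤ CE) (hS : LocStencil S Cs δ) (hM : VertexFamily M N CM δ)
    (hS₂ : LocStencil₂ S₂ C₂ δ) (hM₂ : LocStencilFM N M₂ CM₂ δ) (hδ : 0 < δ) (μ ν : Fin (d + 1)) (z : Fin (d + 1) → ℤ) :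
    hessKer (A + E) (vertexOfK (A + E) N S) (W2SymOfK (A + E) N S M S₂ M₂) μ ν z
      = hessKer A (vertexOfK A N S) (W2SymOfK A N S M S₂ M₂) μ ν z
        + (1 / 2) * tadpole E (W2SymOfK A N S M S₂ M₂ μ 0 ν z)
        - (1 / 4) * tadpole (A + E)
            (dM (comp (comp A (dM A N S M ν z)) E + comp (comp E (dM A N S M ν z)) A + comp (comp E (dM A N S M ν z)) E) N S M μ 0
              + dM (comp (comp A (dM A N S M μ 0)) E + comp (comp E (dM A N S M μ 0)) A + comp (comp E (dM A N S M μ 0)) E) N S M ν z)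
        - (1 / 2) * (tr (comp (comp A (vertexOfK A N S μ 0)) (comp E (vertexOfK A N S ν z)))
            + tr (comp (comp E (vertexOfK A N S μ 0)) (comp A (vertexOfK A N S ν z)))
            + bubble E (vertexOfK A N S μ 0) (vertexOfK A N S ν z)) := by
  -- letters at the common rate δ/16
  have hAE : Decays (A + E) (C + CE) δ := decays_add_pi hA hE
  have hA' : Decays A C (δ / 16) := decays_mono hA hC le_rfl (by linarith)
  have hE' : Decays E CE (δ / 16) := decays_mono hE hCE le_rfl (by linarith)
  have hV : VertexFamily (vertexOfK A N S) N ((d + 1 : ℕ) * (C * Cs * ExpKernelCalculus.Zl (d + 1) (δ / 2))) (δ / 16) := fun μ' y' =>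
    biLoc_mono (vertexFamily_vertexOfK hA hC hS hδ le_rfl μ' y') (by
      have := (vertexFamily_vertexOfK (N := N) hA hC hS hδ le_rfl μ' y').nonneg (Sum.inl 0); exact this) (by linarith)
  have hW := vertexFamily₂_W2SymOfK hA hC hδ hS hM hS₂ hM₂
  have hW' := vertexFamily₂_W2SymOfK hAE (add_nonneg hC hCE) hδ hS hM hS₂ hM₂
  -- the generic A-slot words, with `W'` the carrier of `A + E`
  have h := hessKer_add_kernel_words (N := N) hA' hE' hV hW hW' (by linarith : 0 < δ / 16) μ ν z
  -- the vertices are `E`-blind; the carrier differs by the three sandwich words in both bonds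
  have hVE : vertexOfK (A + E) N S = vertexOfK A N S := funext fun μ' => funext fun y' => vertexOfK_add_of_fm hfm S μ' y'
  have hWd : W2SymOfK (A + E) N S M S₂ M₂ μ 0 ν z - W2SymOfK A N S M S₂ M₂ μ 0 ν z
      = -((1 / 2 : ℝ) • (dM (comp (comp A (dM A N S M ν z)) E + comp (comp E (dM A N S M ν z)) A + comp (comp E (dM A N S M ν z)) E) N S M μ 0
          + dM (comp (comp A (dM A N S M μ 0)) E + comp (comp E (dM A N S M μ 0)) A + comp (comp E (dM A N S M μ 0)) E) N S M ν z)) := by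
    rw [W2SymOfK_add_words hfm hmm hA hC hE hCE hS hM hδ S₂ M₂ μ 0 ν z]
    abel
  rw [hVE, h, hWd]
  have ht : tadpole (A + E) (-((1 / 2 : ℝ) • (dM (comp (comp A (dM A N S M ν z)) E + comp (comp E (dM A N S M ν z)) A + comp (comp E (dM A N S M ν z)) E) N S M μ 0
          + dM (comp (comp A (dM A N S M μ 0)) E + comp (comp E (dM A N S M μ 0)) A + comp (comp E (dM A N S M μ 0)) E) N S M ν z)))
      = -(1 / 2 : ℝ) * tadpole (A + E) (dM (comp (comp A (dM A N S M ν z)) E + comp (comp E (dM A N S M ν z)) A + comp (comp E (dM A N S M ν z)) E) N S M μ 0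
          + dM (comp (comp A (dM A N S M μ 0)) E + comp (comp E (dM A N S M μ 0)) A + comp (comp E (dM A N S M μ 0)) E) N S M ν z) := by
    rw [← tadpole_smul, neg_smul]
  rw [ht]
  ring

end WordList

end Summit.QuantumFields.BalabanUV.Beta.FP.FFPerturbationHessWords

end
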